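import Mathlib
import Literature.NumberTheory.LFunctions.DigammaRationalCharacterSums
import Literature.NumberTheory.Transcendental.DigammaRationalTranscendenceProofs
import HarnessLib

/-!
# Euler–Lehmer constants `γ(h,k) = −(Γ'/Γ(h/k) + log k)/k`

Topic `Literature/NumberTheory/LFunctions`; namespace `Literature.NumberTheory.LFunctions.EulerLehmer`.
THEOREMS only (no definition, no named fact, no `sorry`); cell pub-zeta5, P1 g56 — sequel of
`DigammaRationalCharacterSums.lean` (Gauss's `Σ_{a=1}^{q} ψ(a/q) = −q(γ + log q)`) and of P1 g55's
`DigammaRationalTranscendenceProofs.lean` (Murty–Rath Thm 22.6/22.8: differences `ψ(a/q) − ψ(c/q)` are transcendental).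

## Source (read on the page)

J. C. Lagarias, *Euler's constant: Euler's work and modern developments*, Bull. AMS 50 (2013) [Lagarias2013],
§3.8 (p. 26 of the arXiv copy): «In 1961 W. Briggs introduced the notion of an Euler constant associated to an
arithmetic progression of integers. This notion was studied in detail by D. H. Lehmer [Leh75] in 1975. For the
arithmetic progression `h (mod k)` with `0 ≤ h < k` we set
`γ(h,k) := lim_{x→∞} ( Σ_{0<n≤x, n≡h (mod k)} 1/n − (log x)/k )`.
These constants were later termed Euler–Lehmer constants by Murty and Saradha [MS10]. Here one has `γ(0,1) = γ`,
`γ(1,2) = ½(γ + log 2)` and `γ(2,4) = ¼γ`, where `γ` is Euler's constant.» and §3.16, Theorem 3.16.3 (Murty–Saradha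
2010): «In the infinite list of Euler–Lehmer constants `{γ(h,k) : 1 ≤ h < k, k ≥ 2}`, at most one value is an
algebraic number.» [Lehmer1975] (Acta Arith. 27) and [MurtySaradha2010] (J. Number Theory 130) are cited for
provenance; neither text was available to this seat (scan without text layer / fetch time-out).

## What is proved (no definition: `γ(h,k)` occurs only as the VALUE of the limit; `x → ∞` through the integers `M`;
the residue is taken in `1 ≤ h ≤ k`, the class of `k` being `0 (mod k)`)

* **`tendsto_sum_inv_sub_log_div`** — EXISTENCE WITH VALUE: for `1 ≤ h ≤ k`,
  `Σ_{1≤n≤M, n≡h (k)} 1/n − (log M)/k → −(ψ(h/k) + log k)/k` (`ψ = Γ'/Γ`, Mathlib's `Complex.digamma`), from Gauss's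
  limit formula `ψ(w) = lim (log J − Σ_{j≤J} 1/(w+j))` (Andrews–Askey–Roy (1.2.13); the tree's
  `tendsto_log_sub_sum_inv_digamma`) at `w = h/k` and `log M − log⌊(M−h)/k⌋ → log k`;
* `sum_eulerLehmer_eq_eulerMascheroni` — `Σ_{h=1}^{k} γ(h,k) = γ` (Gauss's sum `Σ_h ψ(h/k) = −k(γ + log k)`);
* the printed sample values `γ(0,1) = γ` (`tendsto_harmonic_form`), `γ(1,2) = (γ + log 2)/2`, `γ(2,4) = γ/4`;
* **`transcendental_eulerLehmer_sub`** / **`eq_of_isAlgebraic_eulerLehmer`** — the FIXED-MODULUS shadow of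
  Theorem 3.16.3: for `k ≥ 2`, the differences `γ(a,k) − γ(c,k)` (`(a,k) = 1`, `c = k` or `(c,k) = 1`, `a ≠ c`) are
  transcendental, so at most one of the `γ(a,k)`, `1 ≤ a < k`, `(a,k) = 1`, is algebraic (Murty–Rath Thm 22.6/22.8 via
  P1 g55; Baker's theorem is a theorem of the tree). The printed all-moduli statement is NOT claimed here.

HONEST FRAMING: textbook identities made kernel theorems; nothing here concerns `ζ(5)`.
-/

noncomputable section

open Complex Filter Topology Finset

namespace Literature.NumberTheory.LFunctions.EulerLehmer

/-! ### Re-indexing the progression `n ≡ h (mod k)`, `1 ≤ n ≤ M`, by `n = h + jk` -/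

/-- In `1 ≤ h ≤ k`, a positive `n ≡ h (mod k)` is at least `h`. [folklore] -/
private theorem le_of_modEq {k h n : ℕ} (hh : h ∈ Icc 1 k) (hn1 : 1 ≤ n) (hmod : n ≡ h [MOD k]) : h ≤ n := by
  rw [Finset.mem_Icc] at hh
  by_contra hlt
  rw [not_le] at hlt
  have hnk : n < k := lt_of_lt_of_le hlt hh.2
  have h1 : n % k = n := Nat.mod_eq_of_lt hnk
  unfold Nat.ModEq at hmod
  rcases hh.2.lt_or_eq with hlt' | heq
  · rw [h1, Nat.mod_eq_of_lt hlt'] at hmod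
    omega
  · subst heq
    rw [h1, Nat.mod_self] at hmod
    omega

/-- `Σ_{1≤n≤M, n≡h (k)} f(n) = Σ_{j ≤ (M−h)/k} f(h + jk)` for `1 ≤ h ≤ k`, `h ≤ M`. [folklore] -/
private theorem sum_filter_modEq_eq {k h M : ℕ} (hh : h ∈ Icc 1 k) (hM : h ≤ M) (f : ℕ → ℂ) :
    ∑ n ∈ (Icc 1 M).filter (fun n => n ≡ h [MOD k]), f n = ∑ j ∈ range ((M - h) / k + 1), f (h + j * k) := by
  have hh' := Finset.mem_Icc.mp hh
  have hk : 0 < k := lt_of_lt_of_le hh'.1 hh'.2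
  refine Finset.sum_nbij' (fun n => (n - h) / k) (fun j => h + j * k) ?_ ?_ ?_ ?_ ?_
  · intro n hn
    rw [Finset.mem_filter, Finset.mem_Icc] at hn
    rw [Finset.mem_range]
    exact Nat.lt_succ_of_le (Nat.div_le_div_right (Nat.sub_le_sub_right hn.1.2 h))
  · intro j hj
    rw [Finset.mem_range] at hj
    have hjle : j ≤ (M - h) / k := Nat.le_of_lt_succ hj
    rw [Nat.le_div_iff_mul_le hk] at hjle
    rw [Finset.mem_filter, Finset.mem_Icc]
    refine ⟨⟨by omega, by omega⟩, ?_⟩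
    unfold Nat.ModEq
    rw [Nat.add_mul_mod_self_right]
  · intro n hn
    rw [Finset.mem_filter, Finset.mem_Icc] at hn
    have hle : h ≤ n := le_of_modEq hh hn.1.1 hn.2
    have hdvd : k ∣ n - h := (Nat.modEq_iff_dvd' hle).mp hn.2.symm
    rw [Nat.div_mul_cancel hdvd]
    omega
  · intro j _
    rw [Nat.add_sub_cancel_left, Nat.mul_div_cancel j hk]
  · intro n hn
    rw [Finset.mem_filter, Finset.mem_Icc] at hn
    have hle : h ≤ n := le_of_modEq hh hn.1.1 hn.2
    have hdvd : k ∣ n - h := (Nat.modEq_iff_dvd' hle).mp hn.2.symm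
    congr 1
    rw [Nat.div_mul_cancel hdvd]
    omega

/-! ### Existence and the value `γ(h,k) = −(ψ(h/k) + log k)/k` -/

/-- **Euler–Lehmer constants: existence and value.** For `1 ≤ h ≤ k` the limit
`γ(h,k) = lim_{M→∞} ( Σ_{1≤n≤M, n≡h (mod k)} 1/n − (log M)/k )` exists and equals `−(Γ'/Γ(h/k) + log k)/k`
(Briggs 1961 / Lehmer 1975, as reported in Lagarias §3.8; the class of `h = k` is the progression `0 (mod k)`).
Proof: `Σ_{n≡h} 1/n = (1/k) Σ_{j≤J} 1/(h/k + j)` with `J = ⌊(M−h)/k⌋`, Gauss's limit formula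
`log J − Σ_{j≤J} 1/(w+j) → ψ(w)` (Andrews–Askey–Roy (1.2.13)) and `log M − log J → log k`.
[cite: Lagarias2013, §3.8 (definition of the Euler–Lehmer constants γ(h,k))]
[cite: AndrewsAskeyRoy1999, Thm 1.2.5 (1.2.13)] -/
theorem tendsto_sum_inv_sub_log_div {k h : ℕ} (hh : h ∈ Icc 1 k) :
    Tendsto (fun M : ℕ => (∑ n ∈ (Icc 1 M).filter (fun n => n ≡ h [MOD k]), (1 : ℂ) / n) - (Real.log M : ℂ) / k)
      atTop (𝓝 (-(Complex.digamma ((h : ℂ) / k) + Real.log k) / k)) := by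
  have hh' := Finset.mem_Icc.mp hh
  have hk : 0 < k := lt_of_lt_of_le hh'.1 hh'.2
  have hkR : (0 : ℝ) < k := by exact_mod_cast hk
  have hkC : (k : ℂ) ≠ 0 := by exact_mod_cast hk.ne'
  -- Gauss's limit formula at `w = h/k`
  have hw : 0 < (((h : ℂ) / k)).re := by
    rw [show ((h : ℂ) / k) = (((h : ℝ) / k : ℝ) : ℂ) by push_cast; rfl, Complex.ofReal_re]
    exact div_pos (by exact_mod_cast hh'.1) hkR
  have G := Literature.Analysis.SpecialFunctions.Complex.tendsto_log_sub_sum_inv_digamma hw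
  -- `J(M) = ⌊(M − h)/k⌋ → ∞`
  set J : ℕ → ℕ := fun M => (M - h) / k with hJdef
  have hJ : Tendsto J atTop atTop := by
    refine tendsto_atTop_atTop.mpr fun B => ⟨B * k + h, fun M hM => ?_⟩
    show B ≤ (M - h) / k
    rw [Nat.le_div_iff_mul_le hk]
    omega
  -- `M = J k + (h + (M − h) mod k)` for `M ≥ h`
  have hrem : ∀ M, h ≤ M → (M : ℝ) = (J M : ℝ) * k + ((h + (M - h) % k : ℕ) : ℝ) := by
    intro M hM
    have e := Nat.div_add_mod (M - h) k
    have e' : M = (M - h) / k * k + (h + (M - h) % k) := by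
      rw [mul_comm]
      omega
    have : (M : ℝ) = (((M - h) / k * k + (h + (M - h) % k) : ℕ) : ℝ) := by exact_mod_cast e'
    rw [this]
    push_cast
    simp only [hJdef]
  -- `M / J → k`
  have hratio : Tendsto (fun M : ℕ => (M : ℝ) / (J M : ℝ)) atTop (𝓝 (k : ℝ)) := by
    have hb : Tendsto (fun M : ℕ => ((h + (M - h) % k : ℕ) : ℝ) / (J M : ℝ)) atTop (𝓝 0) := by
      have hlim : Tendsto (fun M : ℕ => ((h + k : ℕ) : ℝ) / (J M : ℝ)) atTop (𝓝 0) :=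
        (tendsto_const_div_atTop_nhds_zero_nat ((h + k : ℕ) : ℝ)).comp hJ
      refine squeeze_zero (fun M => by positivity) (fun M => ?_) hlim
      have hnum : ((h + (M - h) % k : ℕ) : ℝ) ≤ ((h + k : ℕ) : ℝ) := by
        exact_mod_cast Nat.add_le_add_left (Nat.mod_lt _ hk).le h
      exact div_le_div_of_nonneg_right hnum (Nat.cast_nonneg _)
    have h2 : Tendsto (fun M : ℕ => (k : ℝ) + ((h + (M - h) % k : ℕ) : ℝ) / (J M : ℝ)) atTop (𝓝 (k : ℝ)) := by
      simpa using hb.const_add (k : ℝ)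
    refine h2.congr' ?_
    filter_upwards [hJ.eventually_ge_atTop 1, eventually_ge_atTop h] with M hJ1 hM
    have hJ0 : (J M : ℝ) ≠ 0 := by exact_mod_cast (Nat.one_le_iff_ne_zero.mp hJ1)
    rw [hrem M hM]
    field_simp
  -- `log M − log J → log k`
  have hlog : Tendsto (fun M : ℕ => Real.log M - Real.log (J M)) atTop (𝓝 (Real.log k)) := by
    have h1 := ((Real.continuousAt_log hkR.ne').tendsto).comp hratio
    refine h1.congr' ?_
    filter_upwards [hJ.eventually_ge_atTop 1, eventually_ge_atTop h] with M hJ1 hM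
    have hJ0 : (J M : ℝ) ≠ 0 := by exact_mod_cast (Nat.one_le_iff_ne_zero.mp hJ1)
    have hM0 : (M : ℝ) ≠ 0 := by
      have : 1 ≤ M := hh'.1.trans hM
      exact_mod_cast (Nat.one_le_iff_ne_zero.mp this)
    simp only [Function.comp_def]
    rw [Real.log_div hM0 hJ0]
  -- assemble: `P(M) = −(1/k)(log J − Σ 1/(w+j)) − (1/k)(log M − log J)`
  have hmain := ((G.comp hJ).const_mul (-(1 / (k : ℂ)))).sub
    (((Complex.continuous_ofReal.tendsto _).comp hlog).const_mul (1 / (k : ℂ)))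
  have hval : -(1 / (k : ℂ)) * Complex.digamma ((h : ℂ) / k) - 1 / (k : ℂ) * ((Real.log k : ℝ) : ℂ) =
      -(Complex.digamma ((h : ℂ) / k) + Real.log k) / k := by
    field_simp
    ring
  rw [hval] at hmain
  refine hmain.congr' ?_
  filter_upwards [eventually_ge_atTop h] with M hM
  simp only [Function.comp_def]
  rw [sum_filter_modEq_eq hh hM (fun n => (1 : ℂ) / n)]
  -- `1/(h + jk) = (1/k) · 1/(h/k + j)`
  have hterm : ∀ j ∈ range (J M + 1), (1 : ℂ) / ((h + j * k : ℕ) : ℂ) = 1 / (k : ℂ) * (1 / ((h : ℂ) / k + j)) := by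
    intro j _
    have hne : (h : ℂ) / k + j ≠ 0 := by
      have h0 : (0 : ℝ) < h := by exact_mod_cast hh'.1
      have : (0 : ℝ) < (h : ℝ) / k + j := by positivity
      have e : ((h : ℂ) / k + j) = (((h : ℝ) / k + j : ℝ) : ℂ) := by push_cast; rfl
      rw [e]
      exact_mod_cast this.ne'
    push_cast
    field_simp
  rw [Finset.sum_congr rfl hterm, ← Finset.mul_sum]
  push_cast
  ring

/-! ### `Σ_h γ(h,k) = γ` and the printed sample values -/

/-- **`Σ_{h=1}^{k} γ(h,k) = γ`**: the values `−(ψ(h/k) + log k)/k` of the `k` Euler–Lehmer constants modulo `k` sum to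
Euler's constant (Gauss's `Σ_{h=1}^{k} ψ(h/k) = −k(γ + log k)`; equivalently `H_M − log M → γ` split over the
residue classes). [cite: Lagarias2013, §3.8 (γ(0,1) = γ and the reduction to gcd(h,k) = 1)] -/
theorem sum_eulerLehmer_eq_eulerMascheroni (k : ℕ) [NeZero k] :
    ∑ h ∈ Icc 1 k, (-(Complex.digamma ((h : ℂ) / k) + Real.log k) / k) = Real.eulerMascheroniConstant := by
  have hk : (k : ℂ) ≠ 0 := by exact_mod_cast NeZero.ne k
  have hG := DigammaRational.sum_digamma_div_eq k
  simp only [neg_add, add_div, Finset.sum_add_distrib, Finset.sum_const, Nat.card_Icc, add_tsub_cancel_right,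
    nsmul_eq_mul, neg_div, Finset.sum_neg_distrib, ← Finset.sum_div, hG]
  field_simp
  ring

/-- **`γ(0,1) = γ`**: for `k = h = 1` the theorem is `H_M − log M → γ` with the value `−(ψ(1) + log 1) = γ`
(`ψ(1) = −γ`). [cite: Lagarias2013, §3.8 (γ(0,1) = γ)] -/
theorem tendsto_harmonic_form :
    Tendsto (fun M : ℕ => (∑ n ∈ (Icc 1 M).filter (fun n => n ≡ 1 [MOD 1]), (1 : ℂ) / n) - (Real.log M : ℂ) / 1)
      atTop (𝓝 (Real.eulerMascheroniConstant : ℂ)) := by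
  have h := tendsto_sum_inv_sub_log_div (k := 1) (h := 1) (by simp)
  have hval : -(Complex.digamma ((1 : ℕ) / (1 : ℕ) : ℂ) + Real.log (1 : ℕ)) / (1 : ℕ) =
      (Real.eulerMascheroniConstant : ℂ) := by
    simp [Complex.digamma_one]
  rw [hval] at h
  refine h.congr' (Filter.Eventually.of_forall fun M => ?_)
  simp

/-- **`γ(1,2) = ½(γ + log 2)`** (`ψ(1/2) = −γ − 2 log 2`, Mathlib `Complex.digamma_one_half`).
[cite: Lagarias2013, §3.8 (γ(1,2) = (γ + log 2)/2)] -/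
theorem tendsto_eulerLehmer_one_two :
    Tendsto (fun M : ℕ => (∑ n ∈ (Icc 1 M).filter (fun n => n ≡ 1 [MOD 2]), (1 : ℂ) / n) - (Real.log M : ℂ) / 2)
      atTop (𝓝 (((Real.eulerMascheroniConstant + Real.log 2) / 2 : ℝ) : ℂ)) := by
  have h := tendsto_sum_inv_sub_log_div (k := 2) (h := 1) (by simp)
  have e2 : ((Real.log ((2 : ℕ) : ℝ) : ℝ) : ℂ) = Complex.log 2 := by
    rw [Nat.cast_ofNat, Complex.ofReal_log (by norm_num : (0 : ℝ) ≤ 2), Complex.ofReal_ofNat]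
  have e3 : (((Real.eulerMascheroniConstant + Real.log 2) / 2 : ℝ) : ℂ) =
      (Real.eulerMascheroniConstant + Complex.log 2) / 2 := by
    rw [Complex.ofReal_div, Complex.ofReal_add, Complex.ofReal_log (by norm_num : (0 : ℝ) ≤ 2),
      Complex.ofReal_ofNat]
  have hval : -(Complex.digamma ((1 : ℕ) / (2 : ℕ) : ℂ) + Real.log (2 : ℕ)) / (2 : ℕ) =
      (((Real.eulerMascheroniConstant + Real.log 2) / 2 : ℝ) : ℂ) := by
    rw [show ((1 : ℕ) / (2 : ℕ) : ℂ) = 1 / 2 by norm_num, Complex.digamma_one_half, e2, e3]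
    push_cast
    ring
  rw [hval] at h
  exact h

/-- **`γ(2,4) = ¼γ`** (`ψ(2/4) = ψ(1/2) = −γ − 2 log 2` and `log 4 = 2 log 2`).
[cite: Lagarias2013, §3.8 (γ(2,4) = γ/4)] -/
theorem tendsto_eulerLehmer_two_four :
    Tendsto (fun M : ℕ => (∑ n ∈ (Icc 1 M).filter (fun n => n ≡ 2 [MOD 4]), (1 : ℂ) / n) - (Real.log M : ℂ) / 4)
      atTop (𝓝 ((Real.eulerMascheroniConstant / 4 : ℝ) : ℂ)) := by
  have h := tendsto_sum_inv_sub_log_div (k := 4) (h := 2) (by simp)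
  have hlog4 : Real.log ((4 : ℕ) : ℝ) = 2 * Real.log 2 := by
    rw [show ((4 : ℕ) : ℝ) = 2 ^ 2 by norm_num, Real.log_pow]
    norm_num
  have e4 : ((Real.log ((4 : ℕ) : ℝ) : ℝ) : ℂ) = 2 * Complex.log 2 := by
    rw [hlog4, Complex.ofReal_mul, Complex.ofReal_log (by norm_num : (0 : ℝ) ≤ 2), Complex.ofReal_ofNat]
  have hval : -(Complex.digamma ((2 : ℕ) / (4 : ℕ) : ℂ) + Real.log (4 : ℕ)) / (4 : ℕ) =
      ((Real.eulerMascheroniConstant / 4 : ℝ) : ℂ) := by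
    rw [show ((2 : ℕ) / (4 : ℕ) : ℂ) = 1 / 2 by norm_num, Complex.digamma_one_half, e4]
    push_cast
    ring
  rw [hval] at h
  exact h

/-! ### The fixed-modulus transcendence dichotomy -/

/-- **Differences of Euler–Lehmer constants to one modulus are transcendental**: for `k ≥ 2`, `1 ≤ a < k` with
`(a,k) = 1`, and `1 ≤ c ≤ k` with `c = k` or `(c,k) = 1`, `a ≠ c`, the number `γ(a,k) − γ(c,k) =
−(ψ(a/k) − ψ(c/k))/k` is transcendental (Murty–Rath Thm 22.6/22.8 through P1 g55's
`transcendental_digamma_sub_digamma_aux`; Baker's theorem is a theorem of the tree). This is the FIXED-MODULUS shadow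
of Murty–Saradha's theorem (Lagarias Thm 3.16.3 ranges over all moduli; not claimed).
[cite: Lagarias2013, §3.16 Theorem 3.16.3 (Murty–Saradha 2010; fixed-modulus consequence only)] -/
theorem transcendental_eulerLehmer_sub {k a c : ℕ} (hk : 1 < k) (ha1 : 1 ≤ a) (hak : a < k) (ha : a.Coprime k)
    (hc1 : 1 ≤ c) (hck : c ≤ k) (hc : c = k ∨ c.Coprime k) (hac : a ≠ c) :
    Transcendental ℚ (-(Complex.digamma ((a : ℂ) / k) + Real.log k) / k -
      -(Complex.digamma ((c : ℂ) / k) + Real.log k) / k) := by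
  have hkC : (k : ℂ) ≠ 0 := by exact_mod_cast (zero_lt_one.trans hk).ne'
  have hT := Literature.NumberTheory.Transcendental.BakerBirchWirsing.transcendental_digamma_sub_digamma_aux
    hk ha1 hak ha hc1 hck hc hac
  have he : -(Complex.digamma ((a : ℂ) / k) + Real.log k) / k - -(Complex.digamma ((c : ℂ) / k) + Real.log k) / k =
      (-(1 / (k : ℂ))) * (Complex.digamma ((a : ℂ) / k) - Complex.digamma ((c : ℂ) / k)) := by
    field_simp
    ring
  rw [he]
  intro halg
  apply hT
  have hcoef : IsAlgebraic ℚ (-(1 / (k : ℂ))) := by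
    have : IsAlgebraic ℚ ((k : ℚ) : ℂ)⁻¹ := (isAlgebraic_algebraMap (k : ℚ)).inv
    have e : -(1 / (k : ℂ)) = -(((k : ℚ) : ℂ)⁻¹) := by push_cast; ring
    rw [e]
    exact this.neg
  have hcoef0 : -(1 / (k : ℂ)) ≠ 0 := neg_ne_zero.mpr (one_div_ne_zero hkC)
  have h2 : IsAlgebraic ℚ ((-(1 / (k : ℂ)))⁻¹ * (-(1 / (k : ℂ)) *
      (Complex.digamma ((a : ℂ) / k) - Complex.digamma ((c : ℂ) / k)))) := hcoef.inv.mul halg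
  rwa [← mul_assoc, inv_mul_cancel₀ hcoef0, one_mul] at h2

/-- **At most one Euler–Lehmer constant per modulus is algebraic** (fixed `k ≥ 2`, classes `1 ≤ a < k` coprime to
`k`): if `γ(a,k)` and `γ(b,k)` are both algebraic then `a = b`. The fixed-modulus consequence of Lagarias's
Theorem 3.16.3 (Murty–Saradha); the all-moduli statement is not claimed.
[cite: Lagarias2013, §3.16 Theorem 3.16.3 (Murty–Saradha 2010; fixed-modulus consequence only)] -/
theorem eq_of_isAlgebraic_eulerLehmer {k a b : ℕ} (hk : 1 < k) (ha1 : 1 ≤ a) (hak : a < k) (ha : a.Coprime k)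
    (hb1 : 1 ≤ b) (hbk : b < k) (hb : b.Coprime k)
    (halga : IsAlgebraic ℚ (-(Complex.digamma ((a : ℂ) / k) + Real.log k) / k))
    (halgb : IsAlgebraic ℚ (-(Complex.digamma ((b : ℂ) / k) + Real.log k) / k)) : a = b := by
  by_contra hab
  exact transcendental_eulerLehmer_sub hk ha1 hak ha hb1 hbk.le (Or.inr hb) hab (halga.sub halgb)

end Literature.NumberTheory.LFunctions.EulerLehmer

end
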